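import Literature.Probability.LatticeModels.ProdBernoulliIndependence
import Literature.Probability.LatticeModels.SahiThirdOrderCorrelation
import Literature.Probability.Percolation.PercolationEvents
import Summits.CriticalPhenomena.PercolationContinuityZ3.Theorems.PercNearOneGluingNoHeavyQuantLevelTrials
import Mathlib.Tactic.Ring
import Mathlib.Tactic.Linarith
import HarnessLib

/-!
# One-coordinate (pivotal) sections of events under a product measure, and the affine splitting of Sahi's `E₃`

Support file (prover prim-ineq-prove-3 gen 13; `--supports stmt-CriticalPhenomena-4575`).  No definitions, no named facts, no sorries,
no `native_decide`.  Folklore toolkit used by `…SahiCylinderComplementsGeneral` (and reusable for every coordinate-induction on `E₃`).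

For an event `W ⊆ Set ι` and a coordinate `e` the two SECTIONS are `W¹ = {ω | insert e ω ∈ W}` and `W⁰ = {ω | ω ∖ {e} ∈ W}`
(written out in full below — no definitions are introduced; `Quant.determinedBy_compl_of` is reused from `…QuantLevelTrials`); both are determined by the coordinates `≠ e`, decreasing when `W` is,
and determined by `K ∖ {e}` when `W` is determined by `K`.

* `real_inter_section_split`: for `S` determined by the coordinates `≠ e`,
  `μ(S ∩ W) = p_e · μ(S ∩ W¹) + (1 − p_e) · μ(S ∩ W⁰)` (`μ = prodBernoulli p`; independence of `{e ∈ ω}` from events determined off `e`,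
  `prodBernoulli_real_inter_of_determinedBy`).
* `sahiE3_section_split_third`: `E₃(A,B,·)` is affine in the indicator of its third argument, so for `A, B` determined off `e`
  `E₃(A,B,W) = p_e · E₃(A,B,W¹) + (1 − p_e) · E₃(A,B,W⁰)`.
-/

noncomputable section

namespace Summit.CriticalPhenomena.PercolationContinuityZ3.Theorems

namespace SahiE3Sections

open MeasureTheory Literature.Probability.LatticeModels Literature.Probability.Percolation
open scoped Classical

variable {ι : Type*} [Fintype ι]

/-! ### Determinedness helpers -/

omit [Fintype ι] in
/-- Every event is determined by the whole index set. [folklore] -/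
theorem determinedBy_univ_set (A : Set (Set ι)) : DeterminedBy A (Set.univ : Set ι) := by
  rw [determinedBy_iff]
  intro ω ω' h
  simp only [Set.inter_univ] at h
  rw [h]

omit [Fintype ι] in
/-- The cylinder `{S ⊆ ω}` is determined by the coordinates of `S`. [folklore] -/
theorem determinedBy_cyl (S : Finset ι) : DeterminedBy {ω : Set ι | (S : Set ι) ⊆ ω} (S : Set ι) := by
  refine (determinedBy_iff _ _).2 fun ω ω' hωω' => ?_
  show (S : Set ι) ⊆ ω ↔ (S : Set ι) ⊆ ω'
  rw [← Set.inter_eq_right, ← Set.inter_eq_right, hωω']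

omit [Fintype ι] in
/-- If `U` is determined by `K`, then "`ω` with the coordinates of `S` switched on lies in `U`" is determined by `K ∖ S`. [folklore] -/
theorem determinedBy_union_mem_of {U : Set (Set ι)} {K : Set ι} (hU : DeterminedBy U K) (S : Set ι) :
    DeterminedBy {ω : Set ι | ω ∪ S ∈ U} (K \ S) := by
  rw [determinedBy_iff] at hU ⊢
  intro ω ω' h
  simp only [Set.mem_setOf_eq]
  refine hU _ _ ?_
  ext i
  have hi := Set.ext_iff.1 h i
  simp only [Set.mem_inter_iff, Set.mem_sdiff] at hi
  simp only [Set.mem_inter_iff, Set.mem_union]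
  by_cases hiS : i ∈ S
  · simp [hiS]
  · constructor
    · rintro ⟨h1 | h1, h2⟩
      · exact ⟨Or.inl (hi.1 ⟨h1, h2, hiS⟩).1, h2⟩
      · exact absurd h1 hiS
    · rintro ⟨h1 | h1, h2⟩
      · exact ⟨Or.inl (hi.2 ⟨h1, h2, hiS⟩).1, h2⟩
      · exact absurd h1 hiS

/-! ### One-coordinate sections of an event -/

omit [Fintype ι] in
/-- The inner section `{ω | insert e ω ∈ W}` of a decreasing event is decreasing. [folklore] -/
theorem isLowerSet_section_insert {W : Set (Set ι)} (hW : IsLowerSet W) (e : ι) :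
    IsLowerSet {ω : Set ι | insert e ω ∈ W} :=
  fun _ _ hle hω => hW (Set.insert_subset_insert hle) hω

omit [Fintype ι] in
/-- The outer section `{ω | ω ∖ {e} ∈ W}` of a decreasing event is decreasing. [folklore] -/
theorem isLowerSet_section_sdiff {W : Set (Set ι)} (hW : IsLowerSet W) (e : ι) :
    IsLowerSet {ω : Set ι | ω \ {e} ∈ W} :=
  fun _ _ hle hω => hW (Set.sdiff_subset_sdiff_left hle) hω

omit [Fintype ι] in
/-- The inner section of an event determined by `K` is determined by `K ∖ {e}`. [folklore] -/
theorem determinedBy_section_insert {W : Set (Set ι)} {K : Set ι} (hW : DeterminedBy W K) (e : ι) :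
    DeterminedBy {ω : Set ι | insert e ω ∈ W} (K \ {e}) := by
  have h := determinedBy_union_mem_of hW {e}
  have hset : {ω : Set ι | ω ∪ {e} ∈ W} = {ω : Set ι | insert e ω ∈ W} := by
    ext ω; simp only [Set.mem_setOf_eq, Set.union_singleton]
  rw [hset] at h
  exact h

omit [Fintype ι] in
/-- The outer section of an event determined by `K` is determined by `K ∖ {e}`. [folklore] -/
theorem determinedBy_section_sdiff {W : Set (Set ι)} {K : Set ι} (hW : DeterminedBy W K) (e : ι) :
    DeterminedBy {ω : Set ι | ω \ {e} ∈ W} (K \ {e}) := by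
  rw [determinedBy_iff] at hW ⊢
  intro ω ω' h
  simp only [Set.mem_setOf_eq]
  refine hW _ _ ?_
  ext i
  have hi := Set.ext_iff.1 h i
  simp only [Set.mem_inter_iff, Set.mem_sdiff, Set.mem_singleton_iff] at hi ⊢
  tauto

omit [Fintype ι] in
/-- The inner section of any event is determined by the coordinates other than `e`. [folklore] -/
theorem determinedBy_section_insert_compl (W : Set (Set ι)) (e : ι) :
    DeterminedBy {ω : Set ι | insert e ω ∈ W} ((({e} : Finset ι) : Set ι)ᶜ) := by
  have h := determinedBy_section_insert (determinedBy_univ_set W) e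
  rw [Finset.coe_singleton, Set.compl_eq_univ_sdiff]
  exact h

omit [Fintype ι] in
/-- The outer section of any event is determined by the coordinates other than `e`. [folklore] -/
theorem determinedBy_section_sdiff_compl (W : Set (Set ι)) (e : ι) :
    DeterminedBy {ω : Set ι | ω \ {e} ∈ W} ((({e} : Finset ι) : Set ι)ᶜ) := by
  have h := determinedBy_section_sdiff (determinedBy_univ_set W) e
  rw [Finset.coe_singleton, Set.compl_eq_univ_sdiff]
  exact h

/-- **Pivotal splitting along one coordinate.**  For `S` determined by the coordinates `≠ e` and any event `W`:
`μ(S ∩ W) = p_e · μ(S ∩ W¹) + (1 − p_e) · μ(S ∩ W⁰)` with the sections `W¹ = {insert e ω ∈ W}`, `W⁰ = {ω ∖ {e} ∈ W}`. [folklore] -/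
theorem real_inter_section_split (p : ι → unitInterval) (e : ι) {S : Set (Set ι)}
    (hS : DeterminedBy S ((({e} : Finset ι) : Set ι)ᶜ)) (W : Set (Set ι)) :
    (prodBernoulli p).real (S ∩ W) =
      (p e : ℝ) * (prodBernoulli p).real (S ∩ {ω : Set ι | insert e ω ∈ W}) +
        (1 - p e) * (prodBernoulli p).real (S ∩ {ω : Set ι | ω \ {e} ∈ W}) := by
  have hsplit : S ∩ W = ({ω : Set ι | e ∈ ω} ∩ (S ∩ {ω : Set ι | insert e ω ∈ W})) ∪
      ({ω : Set ι | e ∉ ω} ∩ (S ∩ {ω : Set ι | ω \ {e} ∈ W})) := by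
    ext ω
    simp only [Set.mem_inter_iff, Set.mem_union, Set.mem_setOf_eq]
    by_cases he : e ∈ ω
    · rw [Set.insert_eq_of_mem he]; tauto
    · rw [Set.sdiff_singleton_eq_self he]; tauto
  have hdisj : Disjoint ({ω : Set ι | e ∈ ω} ∩ (S ∩ {ω : Set ι | insert e ω ∈ W}))
      ({ω : Set ι | e ∉ ω} ∩ (S ∩ {ω : Set ι | ω \ {e} ∈ W})) := by
    rw [Set.disjoint_left]
    rintro ω ⟨h1, -⟩ ⟨h2, -⟩
    exact h2 h1
  have hIn : DeterminedBy {ω : Set ι | e ∈ ω} ((({e} : Finset ι) : Set ι)) := by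
    have h := determinedBy_cyl ({e} : Finset ι)
    simp only [Finset.coe_singleton, Set.singleton_subset_iff] at h ⊢
    exact h
  have hOut : DeterminedBy {ω : Set ι | e ∉ ω} ((({e} : Finset ι) : Set ι)) := by
    have h := Quant.determinedBy_compl_of hIn
    have hset : ({ω : Set ι | e ∈ ω})ᶜ = {ω : Set ι | e ∉ ω} := by ext ω; simp
    rw [hset] at h
    exact h
  rw [hsplit, measureReal_union hdisj MeasurableSet.of_discrete,
    prodBernoulli_real_inter_of_determinedBy p {e} hIn (hS.inter (determinedBy_section_insert_compl W e))
      MeasurableSet.of_discrete MeasurableSet.of_discrete,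
    prodBernoulli_real_inter_of_determinedBy p {e} hOut (hS.inter (determinedBy_section_sdiff_compl W e))
      MeasurableSet.of_discrete MeasurableSet.of_discrete,
    prodBernoulli_real_setOf_mem, prodBernoulli_real_setOf_notMem]

/-- **`E₃` is affine in its third argument: pivotal splitting.**  For `A, B` determined by the coordinates `≠ e` and any `W`:
`E₃(A,B,W) = p_e E₃(A,B,W¹) + (1 − p_e) E₃(A,B,W⁰)`. [folklore] -/
theorem sahiE3_section_split_third (p : ι → unitInterval) (e : ι) {A B : Set (Set ι)}
    (hA : DeterminedBy A ((({e} : Finset ι) : Set ι)ᶜ)) (hB : DeterminedBy B ((({e} : Finset ι) : Set ι)ᶜ)) (W : Set (Set ι)) :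
    sahiE3 (prodBernoulli p) A B W =
      (p e : ℝ) * sahiE3 (prodBernoulli p) A B {ω : Set ι | insert e ω ∈ W} +
        (1 - p e) * sahiE3 (prodBernoulli p) A B {ω : Set ι | ω \ {e} ∈ W} := by
  have h3 := real_inter_section_split p e (hA.inter hB) W
  have h1 := real_inter_section_split p e hA W
  have h2 := real_inter_section_split p e hB W
  have h0 := real_inter_section_split p e (determinedBy_univ _) W
  simp only [Set.univ_inter] at h0
  simp only [sahiE3_def]
  rw [h3, h1, h2, h0]
  ring

end SahiE3Sections

end Summit.CriticalPhenomena.PercolationContinuityZ3.Theorems
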